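import Summits.QuantumFields.BalabanUV.Beta.GAN24.ArrowInnerShiftBlocks
import Summits.QuantumFields.BalabanUV.Beta.GAN24.ArrowInnerShiftAliasBorder
import Summits.QuantumFields.BalabanUV.Beta.GAN24.AliasFibreBridge

/-!
# `BalabanUV.Beta.GAN24.ArrowInnerShift` — binder row G-an2-4 / (CONV-C), road P1-fibre, row **P1-L10-F4** of the L10 owner's cut
# `HOME/b2b-balaban-gan24-formalise-leaf-16/L10-CUT-M4.md` («(M4) scaled alias-space Neumann, two anchors» = SKELETON-P1 A5 v0.3), PART 2b = THE ROW:
# **INNER LIPSCHITZ** — `‖arrowMat (innerArrow N p) − arrowMat (innerArrow N 0)‖ ≤ cIn(D)·ρ` on the complex polydisc `‖p_i‖ ≤ ρ ≤ 1/2`, UNIFORMLY IN `N`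

NOT IN PRINT; OUR PROOF ATTEMPT.  HONEST FRAMING (cell contract, verbatim): «discharging `BetaPertH` makes Bałaban's UV stability
UNCONDITIONAL — a real constructive-QFT result; it is NOT the continuum limit and NOT the Clay problem.»  HONEST DEPENDENCY (verbatim):
«continuum YM on T⁴ ⇐ BetaPertH ∧ nine spine estimates (0/9 proved); BetaPertH ⇐ (D1) ∧ (D4) ∧ CAP+tail; G-an2-4 gates asym, D1 and
NE2/3/4.»  [folklore] bookkeeping estimates assembled in F1's operator currency (`ArrowOperator`/`ArrowNorms`/`ArrowScaling` BY NAME); NO cited fact,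
NO `def … : Prop` hypothesis, NO wall binder, NO new object (0 `def`).  NOT summit progress; nothing of (CONV-C)'s K-slot `GAN24.CombesThomas.ConvCK 3 Lc`
is discharged here — this is ONE of the four inputs (F3 anchor, F4 = this, F5, F6) of F7's two-anchor Neumann argument for (U1) on the strip.

## Why / how (row F4 of the cut; gan24-p1-g2's ratification CLAIMS l.3191 (1); owner's F1c spec l.3224)
`arrowMat X − arrowMat Y = arrowMat (X − Y)` (F1a `arrowMat_sub`) is arrow-shaped, so F1b's structured bound `ArrowNorms.norm_arrow_le` gives
`‖·‖ ≤ sup_m ‖ΔT̃_m‖ + ‖colBorder (−ΔlocW)‖ + ‖rowBorder ΔborW‖`, and the two borders are bounded in Frobenius norm (`norm_colBorder_le`, `norm_rowBorder_le`).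
The blocks: part 2a `ArrowInnerShiftBlocks.norm_innerArrow_T_sub_le` (`≤ (D+1)²(6D+12)ρ`, every alias).  The borders, in alias currency (dictionary
`AliasFibreBridge.chiHat_eq_chiAl / sflat_eq_sbAl / boxS_eq_SAl / boxSs_eq_SAl_mul_sAl`; the inner radii `1/r_m^k ≤ 1` only help): at the zero alias the four scaled
weights are `O(ρ)`-close to their anchor values `±1` (part 1b), off the zero alias they vanish at the anchor and their squares are summable against
`Π_i wMaj N (m i)` with total `≤ c(D)ρ²` (parts 1c/1d).  Everything is uniform in `N ≥ 1`; constants are displayed polynomials/exponentials in `D` and two square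
roots of such (TRIGGER-P1 c3: symbolic in `D`; no float, no engine number).

## What is proved (general `D`, `N ≥ 1`)
* §1 the INNER-scaled border weights in alias currency: `innerArrow_wE_eq` (`= (r_m²)⁻¹·χ̂_m·(s♭_κ(m)/N)`), `innerArrow_wG_eq` (`= (r_m³)⁻¹·χ̂_m`),
  `innerArrow_wM_eq` (`= r_m⁻¹·S(m)/N^D`), `innerArrow_wQ_eq` (`= (S(m)/N^D)·(s_κ(m)/N)`), and the radius-free difference bounds `norm_innerArrow_wE_sub_le` etc.
* §2 the Frobenius sums: `sum_sq_negLocW_eq`, `sum_sq_borW_eq` (slot sums), **`sum_sq_negLocW_sub_le`** and **`sum_sq_borW_sub_le`**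
  (`Σ_m Σ_s ‖·‖² ≤ sIn(D)·ρ²` with `sIn D = D(12D·3^D + 4)² + (4D·3^D)² + (72D + 4)·9^D(5^D − 1)` displayed inline).
* §3 `norm_arrowMat_sub_le_of_bounds` (abstract assembly: blocks `≤ t`, border Frobenius squares `≤ Sρ²` ⇒ `≤ t + 2√S·ρ`), **`norm_arrowMat_innerArrow_sub_le`**: `(∀ i, ‖p i‖ ≤ ρ) → 0 ≤ ρ → ρ ≤ 1/2 → ‖arrowMat (innerArrow N p) − arrowMat (innerArrow N 0)‖ ≤
  ((D+1)²(6D+12) + 2√(sIn D))·ρ`; the F7-shaped corollary **`hLipIn_innerArrow`** in dimension `d + 1` (binders `∀ p r, (∀ μ, ‖p μ‖ ≤ r) → r ≤ 1/2 → …`,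
  literally F7 part 1's `hLipIn` for `Gin p := arrowMat (innerArrow N p)`, `ρ₁ = 1/2`), its step form **`hLipIn_innerArrow_step`** (`N = Lc^(j+1)`, = F7 part 2's `hF4` of
  `FibreDetStrip.detStrip_of_rows`), and the `N`-UNIFORM packaging **`exists_cIn`**
  (`∃ cIn, 0 ≤ cIn ∧ ∀ N p r, … ≤ cIn·r`).
Unit `b2b-balaban-gan24-formalise-leaf-04` (G-an2-4 formalisation swarm, gen 5), 2026-08-20.
-/

noncomputable section

open Matrix Complex Finset
open scoped Matrix.Norms.L2Operator BigOperators Real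
open Literature.Probability.LatticeModels (TorusSite)
open Summit.QuantumFields.BalabanUV.Beta.GAN24.AliasWeights (wMaj)
open Summit.QuantumFields.BalabanUV.Beta.GAN24.AliasObjects (sAl SAl sbAl SbAl chiAl)
open Summit.QuantumFields.BalabanUV.Beta.GAN24.AliasFibreBridge (chiHat_eq_chiAl sflat_eq_sbAl boxS_eq_SAl boxSs_eq_SAl_mul_sAl)
open Summit.QuantumFields.BalabanUV.Beta.GAN24.ArrowOperator (Loc AIdx ArrowData arrowMat negLocW arrowMat_sub)
open Summit.QuantumFields.BalabanUV.Beta.GAN24.ArrowNorms (colBorder rowBorder norm_colBorder_le norm_rowBorder_le norm_arrow_le)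
open Summit.QuantumFields.BalabanUV.Beta.GAN24.ArrowScaling (radI radI_pos innerArrow scaledArrow_wE scaledArrow_wG scaledArrow_wM scaledArrow_wQ
  arrowMat_eq_norms)
open Summit.QuantumFields.BalabanUV.Beta.GAN24.ArrowInnerShiftZeroBorder (norm_chiAl_origin_sub_one_le norm_SAl_origin_div_sub_one_le
  norm_chiAl_mul_sbAl_origin_div_sub_one_le norm_SAl_mul_sAl_origin_div_sub_one_le)
open Summit.QuantumFields.BalabanUV.Beta.GAN24.ArrowInnerShiftAliasBorder (sum_sq_norm_chiAl_le sum_sq_norm_SAl_div_le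
  sum_sq_norm_chiAl_mul_sbAl_div_le sum_sq_norm_SAl_mul_sAl_div_le)
open Summit.QuantumFields.BalabanUV.Beta.GAN24.ArrowInnerShiftBlocks (one_le_radI norm_innerArrow_T_sub_le)

namespace Summit.QuantumFields.BalabanUV.Beta.GAN24.ArrowInnerShift

variable {D : ℕ} {N : ℕ} [NeZero N]

/-! ## §1 The inner-scaled border weights in alias currency -/

/-- [folklore] `wE` of the inner-scaled data: `(N²/r_m²)·χ̂_m s♭_κ(m)·(1/N³) = (r_m²)⁻¹·χ̂_m·(s♭_κ(m)/N)`. -/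
theorem innerArrow_wE_eq (p : Fin D → ℂ) (m : TorusSite D N) (κ : Fin D) :
    (innerArrow N p).wE m κ = (((radI N m ^ 2)⁻¹ : ℝ) : ℂ) * (chiAl N p m * (sbAl N p m κ / N)) := by
  have hN : (N : ℂ) ≠ 0 := Nat.cast_ne_zero.2 (NeZero.ne N)
  have hr : ((radI N m : ℝ) : ℂ) ≠ 0 := Complex.ofReal_ne_zero.2 (radI_pos m).ne'
  rw [innerArrow, scaledArrow_wE, chiHat_eq_chiAl, sflat_eq_sbAl]
  push_cast
  field_simp

/-- [folklore] `wG` of the inner-scaled data: `(N³/r_m³)·χ̂_m·(1/N³) = (r_m³)⁻¹·χ̂_m`. -/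
theorem innerArrow_wG_eq (p : Fin D → ℂ) (m : TorusSite D N) :
    (innerArrow N p).wG m = (((radI N m ^ 3)⁻¹ : ℝ) : ℂ) * chiAl N p m := by
  have hN : (N : ℂ) ≠ 0 := Nat.cast_ne_zero.2 (NeZero.ne N)
  have hr : ((radI N m : ℝ) : ℂ) ≠ 0 := Complex.ofReal_ne_zero.2 (radI_pos m).ne'
  rw [innerArrow, scaledArrow_wG, chiHat_eq_chiAl]
  push_cast
  field_simp

/-- [folklore] `wM` of the inner-scaled data: `(1/N^{D+1})·S(m)·(N/r_m) = r_m⁻¹·(S(m)/N^D)`. -/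
theorem innerArrow_wM_eq (p : Fin D → ℂ) (m : TorusSite D N) :
    (innerArrow N p).wM m = (((radI N m)⁻¹ : ℝ) : ℂ) * (SAl N p m / (N : ℂ) ^ D) := by
  have hN : (N : ℂ) ≠ 0 := Nat.cast_ne_zero.2 (NeZero.ne N)
  have hr : ((radI N m : ℝ) : ℂ) ≠ 0 := Complex.ofReal_ne_zero.2 (radI_pos m).ne'
  rw [innerArrow, scaledArrow_wM, boxS_eq_SAl]
  push_cast
  field_simp
  ring

/-- [folklore] `wQ` of the inner-scaled data: `N^{−(D+1)}·S(m) s_κ(m) = (S(m)/N^D)·(s_κ(m)/N)`. -/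
theorem innerArrow_wQ_eq (p : Fin D → ℂ) (m : TorusSite D N) (κ : Fin D) :
    (innerArrow N p).wQ m κ = SAl N p m / (N : ℂ) ^ D * (sAl N p m κ / N) := by
  have hN : (N : ℂ) ≠ 0 := Nat.cast_ne_zero.2 (NeZero.ne N)
  rw [innerArrow, scaledArrow_wQ, boxSs_eq_SAl_mul_sAl]
  push_cast
  field_simp
  ring

/-- [folklore] A real factor in `[0, 1]` does not increase a difference: `‖a·x − a·y‖ ≤ ‖x − y‖`. -/
theorem norm_real_mul_sub_le {a : ℝ} (ha0 : 0 ≤ a) (ha1 : a ≤ 1) (x y : ℂ) : ‖(a : ℂ) * x - (a : ℂ) * y‖ ≤ ‖x - y‖ := by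
  rw [← mul_sub, norm_mul, Complex.norm_real, Real.norm_eq_abs, abs_of_nonneg ha0]
  exact (mul_le_mul_of_nonneg_right ha1 (norm_nonneg _)).trans (by rw [one_mul])

/-- [folklore] The inverse powers of the inner radius lie in `[0, 1]`. -/
theorem inv_radI_pow_le_one (m : TorusSite D N) (k : ℕ) : 0 ≤ (radI N m ^ k)⁻¹ ∧ (radI N m ^ k)⁻¹ ≤ 1 :=
  ⟨inv_nonneg.2 (pow_nonneg (radI_pos m).le k), inv_le_one_of_one_le₀ (one_le_pow₀ (one_le_radI m))⟩

/-- [folklore] `wE` shift, radius-free: `‖ΔwE m κ‖ ≤ ‖χ̂_m(p)·(s♭_κ(m)(p)/N) − χ̂_m(0)·(s♭_κ(m)(0)/N)‖`. -/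
theorem norm_innerArrow_wE_sub_le (p : Fin D → ℂ) (m : TorusSite D N) (κ : Fin D) :
    ‖(innerArrow N p).wE m κ - (innerArrow N 0).wE m κ‖
      ≤ ‖chiAl N p m * (sbAl N p m κ / N) - chiAl N 0 m * (sbAl N 0 m κ / N)‖ := by
  rw [innerArrow_wE_eq, innerArrow_wE_eq]
  exact norm_real_mul_sub_le (inv_radI_pow_le_one m 2).1 (inv_radI_pow_le_one m 2).2 _ _

/-- [folklore] `wG` shift, radius-free: `‖ΔwG m‖ ≤ ‖χ̂_m(p) − χ̂_m(0)‖`. -/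
theorem norm_innerArrow_wG_sub_le (p : Fin D → ℂ) (m : TorusSite D N) :
    ‖(innerArrow N p).wG m - (innerArrow N 0).wG m‖ ≤ ‖chiAl N p m - chiAl N 0 m‖ := by
  rw [innerArrow_wG_eq, innerArrow_wG_eq]
  exact norm_real_mul_sub_le (inv_radI_pow_le_one m 3).1 (inv_radI_pow_le_one m 3).2 _ _

/-- [folklore] `wM` shift, radius-free: `‖ΔwM m‖ ≤ ‖S(m)(p)/N^D − S(m)(0)/N^D‖`. -/
theorem norm_innerArrow_wM_sub_le (p : Fin D → ℂ) (m : TorusSite D N) :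
    ‖(innerArrow N p).wM m - (innerArrow N 0).wM m‖ ≤ ‖SAl N p m / (N : ℂ) ^ D - SAl N 0 m / (N : ℂ) ^ D‖ := by
  rw [innerArrow_wM_eq, innerArrow_wM_eq]
  have h := inv_radI_pow_le_one (N := N) m 1
  rw [pow_one] at h
  exact norm_real_mul_sub_le h.1 h.2 _ _

/-- [folklore] `wQ` shift: `‖ΔwQ m κ‖ = ‖(S(m)/N^D)(s_κ(m)/N)(p) − (same at 0)‖`. -/
theorem norm_innerArrow_wQ_sub_eq (p : Fin D → ℂ) (m : TorusSite D N) (κ : Fin D) :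
    ‖(innerArrow N p).wQ m κ - (innerArrow N 0).wQ m κ‖
      = ‖SAl N p m / (N : ℂ) ^ D * (sAl N p m κ / N) - SAl N 0 m / (N : ℂ) ^ D * (sAl N 0 m κ / N)‖ := by
  rw [innerArrow_wQ_eq, innerArrow_wQ_eq]

/-! ## §2 The Frobenius sums of the two borders -/

/-- [folklore] `‖x − y‖² ≤ (2c)²` when `x`, `y` are both `c`-close to `1`. -/
theorem sq_norm_sub_le_of_near_one {x y : ℂ} {c : ℝ} (hx : ‖x - 1‖ ≤ c) (hy : ‖y - 1‖ ≤ c) : ‖x - y‖ ^ 2 ≤ (2 * c) ^ 2 := by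
  have hc : 0 ≤ c := (norm_nonneg _).trans hx
  have h : ‖x - y‖ ≤ 2 * c := by
    have e : x - y = (x - 1) - (y - 1) := by ring
    rw [e]; exact (norm_sub_le _ _).trans (by linarith)
  exact pow_le_pow_left₀ (norm_nonneg _) h 2

/-- [folklore] The anchor `p = 0` lies in every polydisc of nonnegative radius. -/
theorem norm_zero_apply_le {ρ : ℝ} (hρ0 : 0 ≤ ρ) : ∀ i : Fin D, ‖(0 : Fin D → ℂ) i‖ ≤ ρ := fun i => by
  rw [Pi.zero_apply, norm_zero]; exact hρ0

omit [NeZero N] in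
/-- [folklore] SLOT SUM of the column-border difference at one alias: `Σ_s ‖−ΔlocW m s‖² = Σ_κ ‖ΔwE m κ‖² + ‖ΔwG m‖²`. -/
theorem sum_sq_negLocW_eq (X Y : ArrowData D (TorusSite D N)) (m : TorusSite D N) :
    ∑ s, ‖negLocW (X - Y) m s‖ ^ 2 = ∑ κ, ‖X.wE m κ - Y.wE m κ‖ ^ 2 + ‖X.wG m - Y.wG m‖ ^ 2 := by
  have hl : ∀ κ, negLocW (X - Y) m (Sum.inl κ) = -(X.wE m κ - Y.wE m κ) := fun κ => rfl
  have hr : ∀ u, negLocW (X - Y) m (Sum.inr u) = -(X.wG m - Y.wG m) := fun u => rfl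
  rw [Fintype.sum_sum_type]
  simp only [hl, hr, norm_neg, Finset.sum_const, Finset.card_univ, Fintype.card_unit, one_smul]

omit [NeZero N] in
/-- [folklore] SLOT SUM of the row-border difference at one alias: `Σ_s ‖ΔborW m s‖² = Σ_κ ‖ΔwQ m κ‖² + ‖ΔwM m‖²`. -/
theorem sum_sq_borW_eq (X Y : ArrowData D (TorusSite D N)) (m : TorusSite D N) :
    ∑ s, ‖(X - Y).borW m s‖ ^ 2 = ∑ κ, ‖X.wQ m κ - Y.wQ m κ‖ ^ 2 + ‖X.wM m - Y.wM m‖ ^ 2 := by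
  have hl : ∀ κ, (X - Y).borW m (Sum.inl κ) = X.wQ m κ - Y.wQ m κ := fun κ => rfl
  have hr : ∀ u, (X - Y).borW m (Sum.inr u) = X.wM m - Y.wM m := fun u => rfl
  rw [Fintype.sum_sum_type]
  simp only [hl, hr, Finset.sum_const, Finset.card_univ, Fintype.card_unit, one_smul]

/-- [folklore] **COLUMN BORDER, FROBENIUS SQUARE**: for `‖p_i‖ ≤ ρ`, `0 ≤ ρ ≤ 1/2`,
`Σ_m Σ_s ‖negLocW (innerArrow N p − innerArrow N 0) m s‖² ≤ (D·(12D·3^D + 4)² + (4D·3^D)² + (72D + 4)·9^D·(5^D − 1))·ρ²`. -/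
theorem sum_sq_negLocW_sub_le {p : Fin D → ℂ} {ρ : ℝ} (hp : ∀ i, ‖p i‖ ≤ ρ) (hρ0 : 0 ≤ ρ) (hρ : ρ ≤ 1 / 2) :
    ∑ m, ∑ s, ‖negLocW (innerArrow N p - innerArrow N 0) m s‖ ^ 2
      ≤ (D * (12 * D * 3 ^ D + 4) ^ 2 + (4 * D * 3 ^ D) ^ 2 + (72 * D + 4) * 9 ^ D * ((5 : ℝ) ^ D - 1)) * ρ ^ 2 := by
  have hρ1 : ρ ≤ 1 := by linarith
  have h0 := norm_zero_apply_le (D := D) hρ0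
  -- two local bricks (both exist verbatim elsewhere in the tree; kept local to avoid cross-topic imports)
  have sq_norm_sub_le_two : ∀ a b : ℂ, ‖a - b‖ ^ 2 ≤ 2 * ‖a‖ ^ 2 + 2 * ‖b‖ ^ 2 := fun a b => by
    nlinarith [norm_sub_le a b, norm_nonneg (a - b), norm_nonneg a, norm_nonneg b, sq_nonneg (‖a‖ - ‖b‖)]
  have sum_eq_zero_add_sum_erase : ∀ g : TorusSite D N → ℝ,
      ∑ m, g m = g 0 + ∑ m ∈ (Finset.univ : Finset (TorusSite D N)).erase 0, g m :=
    fun g => (Finset.add_sum_erase _ _ (Finset.mem_univ _)).symm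
  simp only [sum_sq_negLocW_eq]
  rw [Finset.sum_add_distrib, sum_eq_zero_add_sum_erase, sum_eq_zero_add_sum_erase (fun m => ‖_‖ ^ 2)]
  -- (A) zero alias, wE
  have hA : ∑ κ, ‖(innerArrow N p).wE 0 κ - (innerArrow N 0).wE 0 κ‖ ^ 2 ≤ D * ((2 * ((6 * D * 3 ^ D + 2) * ρ)) ^ 2) := by
    calc ∑ κ, ‖(innerArrow N p).wE 0 κ - (innerArrow N 0).wE 0 κ‖ ^ 2
        ≤ ∑ _κ : Fin D, (2 * ((6 * D * 3 ^ D + 2) * ρ)) ^ 2 := Finset.sum_le_sum fun κ _ => by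
          refine (pow_le_pow_left₀ (norm_nonneg _) (norm_innerArrow_wE_sub_le p 0 κ) 2).trans ?_
          exact sq_norm_sub_le_of_near_one (norm_chiAl_mul_sbAl_origin_div_sub_one_le hp hρ0 hρ1 κ)
            (norm_chiAl_mul_sbAl_origin_div_sub_one_le h0 hρ0 hρ1 κ)
      _ = D * ((2 * ((6 * D * 3 ^ D + 2) * ρ)) ^ 2) := by rw [Finset.sum_const, Finset.card_univ, Fintype.card_fin, nsmul_eq_mul]
  -- (B) off the zero alias, wE
  have hB : ∑ m ∈ (Finset.univ : Finset (TorusSite D N)).erase 0, ∑ κ, ‖(innerArrow N p).wE m κ - (innerArrow N 0).wE m κ‖ ^ 2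
      ≤ 4 * (D * 18 * 9 ^ D * ((5 : ℝ) ^ D - 1) * ρ ^ 2) := by
    have h1 := sum_sq_norm_chiAl_mul_sbAl_div_le (N := N) hp hρ
    have h2 := sum_sq_norm_chiAl_mul_sbAl_div_le (N := N) h0 hρ
    calc ∑ m ∈ (Finset.univ : Finset (TorusSite D N)).erase 0, ∑ κ, ‖(innerArrow N p).wE m κ - (innerArrow N 0).wE m κ‖ ^ 2
        ≤ ∑ m ∈ (Finset.univ : Finset (TorusSite D N)).erase 0, ∑ κ,
            (2 * ‖chiAl N p m * (sbAl N p m κ / N)‖ ^ 2 + 2 * ‖chiAl N 0 m * (sbAl N 0 m κ / N)‖ ^ 2) :=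
          Finset.sum_le_sum fun m _ => Finset.sum_le_sum fun κ _ =>
            (pow_le_pow_left₀ (norm_nonneg _) (norm_innerArrow_wE_sub_le p m κ) 2).trans (sq_norm_sub_le_two _ _)
      _ = 2 * ∑ m ∈ (Finset.univ : Finset (TorusSite D N)).erase 0, ∑ κ, ‖chiAl N p m * (sbAl N p m κ / N)‖ ^ 2
          + 2 * ∑ m ∈ (Finset.univ : Finset (TorusSite D N)).erase 0, ∑ κ, ‖chiAl N 0 m * (sbAl N 0 m κ / N)‖ ^ 2 := by
          simp only [Finset.sum_add_distrib, Finset.mul_sum]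
      _ ≤ 4 * (D * 18 * 9 ^ D * ((5 : ℝ) ^ D - 1) * ρ ^ 2) := by linarith
  -- (C) zero alias, wG
  have hC : ‖(innerArrow N p).wG 0 - (innerArrow N 0).wG 0‖ ^ 2 ≤ (2 * (2 * D * 3 ^ D * ρ)) ^ 2 :=
    (pow_le_pow_left₀ (norm_nonneg _) (norm_innerArrow_wG_sub_le p 0) 2).trans
      (sq_norm_sub_le_of_near_one (norm_chiAl_origin_sub_one_le hp hρ0 hρ1) (norm_chiAl_origin_sub_one_le h0 hρ0 hρ1))
  -- (D) off the zero alias, wG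
  have hD' : ∑ m ∈ (Finset.univ : Finset (TorusSite D N)).erase 0, ‖(innerArrow N p).wG m - (innerArrow N 0).wG m‖ ^ 2
      ≤ 4 * (9 ^ D * ((5 : ℝ) ^ D - 1) * ρ ^ 2) := by
    have h1 := sum_sq_norm_chiAl_le (N := N) hp hρ
    have h2 := sum_sq_norm_chiAl_le (N := N) h0 hρ
    calc ∑ m ∈ (Finset.univ : Finset (TorusSite D N)).erase 0, ‖(innerArrow N p).wG m - (innerArrow N 0).wG m‖ ^ 2
        ≤ ∑ m ∈ (Finset.univ : Finset (TorusSite D N)).erase 0, (2 * ‖chiAl N p m‖ ^ 2 + 2 * ‖chiAl N 0 m‖ ^ 2) :=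
          Finset.sum_le_sum fun m _ =>
            (pow_le_pow_left₀ (norm_nonneg _) (norm_innerArrow_wG_sub_le p m) 2).trans (sq_norm_sub_le_two _ _)
      _ = 2 * ∑ m ∈ (Finset.univ : Finset (TorusSite D N)).erase 0, ‖chiAl N p m‖ ^ 2
          + 2 * ∑ m ∈ (Finset.univ : Finset (TorusSite D N)).erase 0, ‖chiAl N 0 m‖ ^ 2 := by
          simp only [Finset.sum_add_distrib, Finset.mul_sum]
      _ ≤ 4 * (9 ^ D * ((5 : ℝ) ^ D - 1) * ρ ^ 2) := by linarith
  have h5 : (0 : ℝ) ≤ (5 : ℝ) ^ D - 1 := by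
    have := one_le_pow₀ (M₀ := ℝ) (a := 5) (by norm_num) (n := D); linarith
  have hDn : (0 : ℝ) ≤ D := Nat.cast_nonneg D
  calc ∑ κ, ‖(innerArrow N p).wE 0 κ - (innerArrow N 0).wE 0 κ‖ ^ 2
        + ∑ m ∈ (Finset.univ : Finset (TorusSite D N)).erase 0, ∑ κ, ‖(innerArrow N p).wE m κ - (innerArrow N 0).wE m κ‖ ^ 2
        + (‖(innerArrow N p).wG 0 - (innerArrow N 0).wG 0‖ ^ 2
          + ∑ m ∈ (Finset.univ : Finset (TorusSite D N)).erase 0, ‖(innerArrow N p).wG m - (innerArrow N 0).wG m‖ ^ 2)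
      ≤ D * ((2 * ((6 * D * 3 ^ D + 2) * ρ)) ^ 2) + 4 * (D * 18 * 9 ^ D * ((5 : ℝ) ^ D - 1) * ρ ^ 2)
        + ((2 * (2 * D * 3 ^ D * ρ)) ^ 2 + 4 * (9 ^ D * ((5 : ℝ) ^ D - 1) * ρ ^ 2)) := by linarith
    _ = (D * (12 * D * 3 ^ D + 4) ^ 2 + (4 * D * 3 ^ D) ^ 2 + (72 * D + 4) * 9 ^ D * ((5 : ℝ) ^ D - 1)) * ρ ^ 2 := by ring

/-- [folklore] **ROW BORDER, FROBENIUS SQUARE**: the same bound for `Σ_m Σ_s ‖(innerArrow N p − innerArrow N 0).borW m s‖²`. -/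
theorem sum_sq_borW_sub_le {p : Fin D → ℂ} {ρ : ℝ} (hp : ∀ i, ‖p i‖ ≤ ρ) (hρ0 : 0 ≤ ρ) (hρ : ρ ≤ 1 / 2) :
    ∑ m, ∑ s, ‖(innerArrow N p - innerArrow N 0).borW m s‖ ^ 2
      ≤ (D * (12 * D * 3 ^ D + 4) ^ 2 + (4 * D * 3 ^ D) ^ 2 + (72 * D + 4) * 9 ^ D * ((5 : ℝ) ^ D - 1)) * ρ ^ 2 := by
  have hρ1 : ρ ≤ 1 := by linarith
  have h0 := norm_zero_apply_le (D := D) hρ0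
  -- two local bricks (both exist verbatim elsewhere in the tree; kept local to avoid cross-topic imports)
  have sq_norm_sub_le_two : ∀ a b : ℂ, ‖a - b‖ ^ 2 ≤ 2 * ‖a‖ ^ 2 + 2 * ‖b‖ ^ 2 := fun a b => by
    nlinarith [norm_sub_le a b, norm_nonneg (a - b), norm_nonneg a, norm_nonneg b, sq_nonneg (‖a‖ - ‖b‖)]
  have sum_eq_zero_add_sum_erase : ∀ g : TorusSite D N → ℝ,
      ∑ m, g m = g 0 + ∑ m ∈ (Finset.univ : Finset (TorusSite D N)).erase 0, g m :=
    fun g => (Finset.add_sum_erase _ _ (Finset.mem_univ _)).symm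
  have hNpow : ∀ m : TorusSite D N, ∀ q : Fin D → ℂ, ‖SAl N q m / (N : ℂ) ^ D‖ = ‖SAl N q m‖ / (N : ℝ) ^ D := fun m q => by
    rw [norm_div, norm_pow, Complex.norm_natCast]
  simp only [sum_sq_borW_eq]
  rw [Finset.sum_add_distrib, sum_eq_zero_add_sum_erase, sum_eq_zero_add_sum_erase (fun m => ‖_‖ ^ 2)]
  -- (A) zero alias, wQ
  have hA : ∑ κ, ‖(innerArrow N p).wQ 0 κ - (innerArrow N 0).wQ 0 κ‖ ^ 2 ≤ D * ((2 * ((6 * D * 3 ^ D + 2) * ρ)) ^ 2) := by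
    calc ∑ κ, ‖(innerArrow N p).wQ 0 κ - (innerArrow N 0).wQ 0 κ‖ ^ 2
        ≤ ∑ _κ : Fin D, (2 * ((6 * D * 3 ^ D + 2) * ρ)) ^ 2 := Finset.sum_le_sum fun κ _ => by
          rw [norm_innerArrow_wQ_sub_eq]
          exact sq_norm_sub_le_of_near_one (norm_SAl_mul_sAl_origin_div_sub_one_le hp hρ0 hρ1 κ)
            (norm_SAl_mul_sAl_origin_div_sub_one_le h0 hρ0 hρ1 κ)
      _ = D * ((2 * ((6 * D * 3 ^ D + 2) * ρ)) ^ 2) := by rw [Finset.sum_const, Finset.card_univ, Fintype.card_fin, nsmul_eq_mul]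
  -- (B) off the zero alias, wQ
  have hB : ∑ m ∈ (Finset.univ : Finset (TorusSite D N)).erase 0, ∑ κ, ‖(innerArrow N p).wQ m κ - (innerArrow N 0).wQ m κ‖ ^ 2
      ≤ 4 * (D * 18 * 9 ^ D * ((5 : ℝ) ^ D - 1) * ρ ^ 2) := by
    have h1 := sum_sq_norm_SAl_mul_sAl_div_le (N := N) hp hρ
    have h2 := sum_sq_norm_SAl_mul_sAl_div_le (N := N) h0 hρ
    calc ∑ m ∈ (Finset.univ : Finset (TorusSite D N)).erase 0, ∑ κ, ‖(innerArrow N p).wQ m κ - (innerArrow N 0).wQ m κ‖ ^ 2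
        ≤ ∑ m ∈ (Finset.univ : Finset (TorusSite D N)).erase 0, ∑ κ,
            (2 * ‖SAl N p m / (N : ℂ) ^ D * (sAl N p m κ / N)‖ ^ 2 + 2 * ‖SAl N 0 m / (N : ℂ) ^ D * (sAl N 0 m κ / N)‖ ^ 2) :=
          Finset.sum_le_sum fun m _ => Finset.sum_le_sum fun κ _ => by
            rw [norm_innerArrow_wQ_sub_eq]; exact sq_norm_sub_le_two _ _
      _ = 2 * ∑ m ∈ (Finset.univ : Finset (TorusSite D N)).erase 0, ∑ κ, ‖SAl N p m / (N : ℂ) ^ D * (sAl N p m κ / N)‖ ^ 2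
          + 2 * ∑ m ∈ (Finset.univ : Finset (TorusSite D N)).erase 0, ∑ κ, ‖SAl N 0 m / (N : ℂ) ^ D * (sAl N 0 m κ / N)‖ ^ 2 := by
          simp only [Finset.sum_add_distrib, Finset.mul_sum]
      _ ≤ 4 * (D * 18 * 9 ^ D * ((5 : ℝ) ^ D - 1) * ρ ^ 2) := by linarith
  -- (C) zero alias, wM
  have hC : ‖(innerArrow N p).wM 0 - (innerArrow N 0).wM 0‖ ^ 2 ≤ (2 * (2 * D * 3 ^ D * ρ)) ^ 2 :=
    (pow_le_pow_left₀ (norm_nonneg _) (norm_innerArrow_wM_sub_le p 0) 2).trans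
      (sq_norm_sub_le_of_near_one (norm_SAl_origin_div_sub_one_le hp hρ0 hρ1) (norm_SAl_origin_div_sub_one_le h0 hρ0 hρ1))
  -- (D) off the zero alias, wM
  have hD' : ∑ m ∈ (Finset.univ : Finset (TorusSite D N)).erase 0, ‖(innerArrow N p).wM m - (innerArrow N 0).wM m‖ ^ 2
      ≤ 4 * (9 ^ D * ((5 : ℝ) ^ D - 1) * ρ ^ 2) := by
    have h1 := sum_sq_norm_SAl_div_le (N := N) hp hρ
    have h2 := sum_sq_norm_SAl_div_le (N := N) h0 hρ
    calc ∑ m ∈ (Finset.univ : Finset (TorusSite D N)).erase 0, ‖(innerArrow N p).wM m - (innerArrow N 0).wM m‖ ^ 2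
        ≤ ∑ m ∈ (Finset.univ : Finset (TorusSite D N)).erase 0,
            (2 * (‖SAl N p m‖ / (N : ℝ) ^ D) ^ 2 + 2 * (‖SAl N 0 m‖ / (N : ℝ) ^ D) ^ 2) :=
          Finset.sum_le_sum fun m _ => by
            refine (pow_le_pow_left₀ (norm_nonneg _) (norm_innerArrow_wM_sub_le p m) 2).trans ?_
            rw [← hNpow m p, ← hNpow m 0]; exact sq_norm_sub_le_two _ _
      _ = 2 * ∑ m ∈ (Finset.univ : Finset (TorusSite D N)).erase 0, (‖SAl N p m‖ / (N : ℝ) ^ D) ^ 2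
          + 2 * ∑ m ∈ (Finset.univ : Finset (TorusSite D N)).erase 0, (‖SAl N 0 m‖ / (N : ℝ) ^ D) ^ 2 := by
          simp only [Finset.sum_add_distrib, Finset.mul_sum]
      _ ≤ 4 * (9 ^ D * ((5 : ℝ) ^ D - 1) * ρ ^ 2) := by linarith
  calc ∑ κ, ‖(innerArrow N p).wQ 0 κ - (innerArrow N 0).wQ 0 κ‖ ^ 2
        + ∑ m ∈ (Finset.univ : Finset (TorusSite D N)).erase 0, ∑ κ, ‖(innerArrow N p).wQ m κ - (innerArrow N 0).wQ m κ‖ ^ 2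
        + (‖(innerArrow N p).wM 0 - (innerArrow N 0).wM 0‖ ^ 2
          + ∑ m ∈ (Finset.univ : Finset (TorusSite D N)).erase 0, ‖(innerArrow N p).wM m - (innerArrow N 0).wM m‖ ^ 2)
      ≤ D * ((2 * ((6 * D * 3 ^ D + 2) * ρ)) ^ 2) + 4 * (D * 18 * 9 ^ D * ((5 : ℝ) ^ D - 1) * ρ ^ 2)
        + ((2 * (2 * D * 3 ^ D * ρ)) ^ 2 + 4 * (9 ^ D * ((5 : ℝ) ^ D - 1) * ρ ^ 2)) := by linarith
    _ = (D * (12 * D * 3 ^ D + 4) ^ 2 + (4 * D * 3 ^ D) ^ 2 + (72 * D + 4) * 9 ^ D * ((5 : ℝ) ^ D - 1)) * ρ ^ 2 := by ring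

/-! ## §3 The inner Lipschitz bound -/

/-- [folklore] The border constant is nonnegative. -/
theorem sIn_nonneg (D : ℕ) : (0 : ℝ) ≤ D * (12 * D * 3 ^ D + 4) ^ 2 + (4 * D * 3 ^ D) ^ 2 + (72 * D + 4) * 9 ^ D * ((5 : ℝ) ^ D - 1) := by
  have h5 : (0 : ℝ) ≤ (5 : ℝ) ^ D - 1 := by
    have := one_le_pow₀ (M₀ := ℝ) (a := 5) (by norm_num) (n := D); linarith
  positivity

/-- [folklore] From a Frobenius-square bound `Σ ≤ S·ρ²` to `√Σ ≤ √S·ρ`. -/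
theorem sqrt_le_of_sq_bound {T S ρ : ℝ} (hS : 0 ≤ S) (hρ0 : 0 ≤ ρ) (h : T ≤ S * ρ ^ 2) : Real.sqrt T ≤ Real.sqrt S * ρ := by
  calc Real.sqrt T ≤ Real.sqrt (S * ρ ^ 2) := Real.sqrt_le_sqrt h
    _ = Real.sqrt S * ρ := by rw [Real.sqrt_mul hS, Real.sqrt_sq hρ0]

/-- [folklore] ABSTRACT ASSEMBLY (F1b's structured bound + the two Frobenius bounds): if every block of `X − Y` is `≤ t` in operator norm and both
border Frobenius squares are `≤ S·ρ²`, then `‖arrowMat X − arrowMat Y‖ ≤ t + 2·√S·ρ`. -/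
theorem norm_arrowMat_sub_le_of_bounds {X Y : ArrowData D (TorusSite D N)} {t S ρ : ℝ} (ht : 0 ≤ t) (hS : 0 ≤ S) (hρ0 : 0 ≤ ρ)
    (hT : ∀ m, ‖X.T m - Y.T m‖ ≤ t) (hcol : ∑ m, ∑ s, ‖negLocW (X - Y) m s‖ ^ 2 ≤ S * ρ ^ 2)
    (hrow : ∑ m, ∑ s, ‖(X - Y).borW m s‖ ^ 2 ≤ S * ρ ^ 2) :
    ‖arrowMat X - arrowMat Y‖ ≤ t + 2 * Real.sqrt S * ρ := by
  rw [arrowMat_sub, arrowMat_eq_norms]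
  have hblocks : ∀ m, ‖(X - Y).T m‖ ≤ t := fun m => by rw [ArrowData.sub_T]; exact hT m
  have hc : ‖colBorder (negLocW (X - Y))‖ ≤ Real.sqrt S * ρ := (norm_colBorder_le _).trans (sqrt_le_of_sq_bound hS hρ0 hcol)
  have hr : ‖rowBorder (X - Y).borW‖ ≤ Real.sqrt S * ρ := (norm_rowBorder_le _).trans (sqrt_le_of_sq_bound hS hρ0 hrow)
  calc ‖fromBlocks (blockDiagonal (X - Y).T) (colBorder (negLocW (X - Y))) (rowBorder (X - Y).borW) 0‖
      ≤ t + ‖colBorder (negLocW (X - Y))‖ + ‖rowBorder (X - Y).borW‖ := norm_arrow_le _ _ _ ht hblocks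
    _ ≤ t + 2 * Real.sqrt S * ρ := by linarith

/-- **ROW F4 — INNER LIPSCHITZ BOUND** (explicit constant).  For every `N ≥ 1`, every complex `p` with `‖p_i‖ ≤ ρ`, `0 ≤ ρ ≤ 1/2`:
`‖arrowMat (innerArrow N p) − arrowMat (innerArrow N 0)‖ ≤ ((D+1)²(6D+12) + 2·√(D(12D·3^D + 4)² + (4D·3^D)² + (72D + 4)·9^D(5^D − 1)))·ρ`.  [folklore] -/
theorem norm_arrowMat_innerArrow_sub_le {p : Fin D → ℂ} {ρ : ℝ} (hp : ∀ i, ‖p i‖ ≤ ρ) (hρ0 : 0 ≤ ρ) (hρ : ρ ≤ 1 / 2) :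
    ‖arrowMat (innerArrow N p) - arrowMat (innerArrow N 0)‖
      ≤ (((D : ℝ) + 1) ^ 2 * (6 * D + 12)
          + 2 * Real.sqrt (D * (12 * D * 3 ^ D + 4) ^ 2 + (4 * D * 3 ^ D) ^ 2 + (72 * D + 4) * 9 ^ D * ((5 : ℝ) ^ D - 1))) * ρ := by
  have ht : 0 ≤ ((D : ℝ) + 1) ^ 2 * (6 * D + 12) * ρ := by positivity
  have h := norm_arrowMat_sub_le_of_bounds (N := N) ht (sIn_nonneg D) hρ0 (norm_innerArrow_T_sub_le hp hρ0 hρ)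
    (sum_sq_negLocW_sub_le hp hρ0 hρ) (sum_sq_borW_sub_le hp hρ0 hρ)
  refine h.trans (le_of_eq ?_)
  ring

/-- **ROW F4 IN F7's SHAPE** (`FibreDetStripOfAnchors`' hypothesis `hLipIn` for `Gin p := arrowMat (innerArrow N p)`, `ρ₁ = 1/2`), dimension `d + 1`
(so that `r ≥ ‖p 0‖ ≥ 0` is automatic): `∀ p r, (∀ μ, ‖p μ‖ ≤ r) → r ≤ 1/2 → ‖arrowMat (innerArrow N p) − arrowMat (innerArrow N 0)‖ ≤ cIn·r`.  [folklore] -/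
theorem hLipIn_innerArrow (d : ℕ) (N : ℕ) [NeZero N] :
    ∀ (p : Fin (d + 1) → ℂ) (r : ℝ), (∀ μ, ‖p μ‖ ≤ r) → r ≤ 1 / 2 →
      ‖arrowMat (innerArrow N p) - arrowMat (innerArrow N 0)‖
        ≤ ((((d + 1 : ℕ) : ℝ) + 1) ^ 2 * (6 * ((d + 1 : ℕ) : ℝ) + 12)
            + 2 * Real.sqrt (((d + 1 : ℕ) : ℝ) * (12 * ((d + 1 : ℕ) : ℝ) * 3 ^ (d + 1) + 4) ^ 2 + (4 * ((d + 1 : ℕ) : ℝ) * 3 ^ (d + 1)) ^ 2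
                + (72 * ((d + 1 : ℕ) : ℝ) + 4) * 9 ^ (d + 1) * ((5 : ℝ) ^ (d + 1) - 1))) * r := by
  intro p r hp hr
  have hr0 : 0 ≤ r := (norm_nonneg _).trans (hp 0)
  exact norm_arrowMat_innerArrow_sub_le hp hr0 hr

/-- **ROW F4 AT EVERY STEP `N = Lc^(j+1)`** — LITERALLY the hypothesis `hF4` of F7's `FibreDetStrip.detStrip_of_rows` / `apriori_of_rows_step` with `ρ₁ = 1/2` and the
`j`-INDEPENDENT constant `cIn(d+1)` displayed above.  [folklore] -/
theorem hLipIn_innerArrow_step (d Lc : ℕ) [NeZero Lc] :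
    ∀ (j : ℕ) (p : Fin (d + 1) → ℂ) (r : ℝ), (∀ μ, ‖p μ‖ ≤ r) → r ≤ 1 / 2 →
      ‖arrowMat (innerArrow (Lc ^ (j + 1)) p) - arrowMat (innerArrow (Lc ^ (j + 1)) 0)‖
        ≤ ((((d + 1 : ℕ) : ℝ) + 1) ^ 2 * (6 * ((d + 1 : ℕ) : ℝ) + 12)
            + 2 * Real.sqrt (((d + 1 : ℕ) : ℝ) * (12 * ((d + 1 : ℕ) : ℝ) * 3 ^ (d + 1) + 4) ^ 2 + (4 * ((d + 1 : ℕ) : ℝ) * 3 ^ (d + 1)) ^ 2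
                + (72 * ((d + 1 : ℕ) : ℝ) + 4) * 9 ^ (d + 1) * ((5 : ℝ) ^ (d + 1) - 1))) * r :=
  fun j => hLipIn_innerArrow d (Lc ^ (j + 1))

/-- **ROW F4, `N`-UNIFORM PACKAGING**: there is ONE constant `cIn ≥ 0` (depending on the dimension only) such that for EVERY block side `N ≥ 1`,
every complex `p` and every `r ≤ 1/2` with `‖p_μ‖ ≤ r`:  `‖arrowMat (innerArrow N p) − arrowMat (innerArrow N 0)‖ ≤ cIn·r`.  [folklore] -/
theorem exists_cIn (d : ℕ) :
    ∃ cIn : ℝ, 0 ≤ cIn ∧ ∀ (N : ℕ) [NeZero N] (p : Fin (d + 1) → ℂ) (r : ℝ), (∀ μ, ‖p μ‖ ≤ r) → r ≤ 1 / 2 →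
      ‖arrowMat (innerArrow N p) - arrowMat (innerArrow N 0)‖ ≤ cIn * r := by
  refine ⟨_, ?_, fun N _ p r hp hr => hLipIn_innerArrow d N p r hp hr⟩
  have := sIn_nonneg (d + 1)
  positivity

end Summit.QuantumFields.BalabanUV.Beta.GAN24.ArrowInnerShift

end
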